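import Summits.Ventures.DiscreteObjects.Hadamard.PrimeOrder17to47

/-!
# Hadamard 668 census, family F12 — order 13: exactly 48 + 48 orbits and 43 + 43 fixed elements (kernel, no parity theorem)

Framing: lottery ticket; floor = certified bounds/negative ranges.

Cell pub-namedobj (venture DiscreteObjects), target (H), hadamard gen 6.  The census line (FAMILY-F12-G5 §9) records for `p = 13`
the forced orbit number `m = 48` (`f = 43`), obtained from the orbit-row test together with Lander's parity theorem (odd `m`) and a
paper fixed-point argument (`m = 50`).  Cauchy–Schwarz alone leaves `m ∈ {48, 49, 50, 51}` (`cs13`, `decide`).  This file removes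
`49, 50, 51` INSIDE THE KERNEL, for a `0/1` incidence function with `|P| = |B| = 667`, row and column sums `333`, inner products
`166` of distinct rows and of distinct columns, and an automorphism pair `(ρ, τ)`, `ρ^13 = τ^13 = 1`, `ρ ≠ 1`:
a fixed point lies on `c ≡ 333 ≡ 8 (mod 13)` fixed blocks, two fixed points share `u ≡ 166 ≡ 10 (mod 13) ≤ c` of them
(`FixedStructure`); `4` fixed blocks: `c ≥ 8` impossible; `17`: `c = 8 < 10 ≤ u`; `30`: `c = 21`, `u = 10` for all fixed points —
then `30 + 30` dies by counting `Σ_{x'} u(x,x')` (`21·21 ≠ 21 + 29·10`) and `30 + 43` by the double count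
`Σ_y c_y² = 43·441 = 21·Σ_y c_y` with `c_y ∈ {21, 34}`, forcing all `c_y = 21` and `Σ_y c_y = 630 ≠ 903`.
MAIN: `orbitStructure_13` — `43` fixed points, `43` fixed blocks, `48 + 48` orbits of length `13`.  Ours; no `sorry`.
-/

open Finset BigOperators

namespace Summit.Ventures.DiscreteObjects.Hadamard

variable {P B : Type*} [Fintype P] [DecidableEq P] [Fintype B] [DecidableEq B]

set_option maxRecDepth 100000 in
/-- `p = 13`: every orbit number except `48, 49, 50, 51` has negative discriminant -/
lemma cs13 : ∀ m ∈ Finset.range 52, 1 ≤ m → m ≠ 48 → m ≠ 49 → m ≠ 50 → m ≠ 51 →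
    (0 : ℤ) < 4 * (333 ^ 2 - (m : ℤ) * (167 + 166 * 13)) - (666 - (m : ℤ) * 13) ^ 2 := by decide

/-- one side, `p = 13`: the number `F` of fixed blocks is `43, 30, 17` or `4`; with two fixed points available `F ∈ {43, 30}`,
and `F = 30` forces `c = 21`, `u = 10`, while `F = 43` forces `c ∈ {21, 34}` -/
lemma side13 (N : P → B → ℤ) (h01 : ∀ x y, N x y = 0 ∨ N x y = 1)
    (hrow : ∀ x, ∑ y, N x y = 333) (hpair : ∀ x x', x ≠ x' → ∑ y, N x y * N x' y = 166)
    (hB : Fintype.card B = 667)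
    (ρ : Equiv.Perm P) (τ : Equiv.Perm B) (hN : ∀ x y, N (ρ x) (τ y) = N x y)
    (hρ : ρ ^ 13 = 1) (hτ : τ ^ 13 = 1) (x₀ : P) (hx₀ : ρ x₀ ≠ x₀)
    {x₁ x₂ : P} (hx₁ : ρ x₁ = x₁) (hx₂ : ρ x₂ = x₂) (h12 : x₁ ≠ x₂) :
    ((univ.filter fun y => τ y = y).card = 30 ∧
      (∀ x, ρ x = x → ∑ y ∈ univ.filter (fun y => τ y = y), N x y = 21) ∧
      (∀ x x', ρ x = x → ρ x' = x' → x ≠ x' → ∑ y ∈ univ.filter (fun y => τ y = y), N x y * N x' y = 10)) ∨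
    ((univ.filter fun y => τ y = y).card = 43 ∧
      (∀ x, ρ x = x → ∑ y ∈ univ.filter (fun y => τ y = y), N x y = 21 ∨
        ∑ y ∈ univ.filter (fun y => τ y = y), N x y = 34)) := by
  have hp : (13 : ℕ).Prime := by norm_num
  obtain ⟨hm1, σ, cs⟩ := orbitCount_cs N h01 hrow hpair 13 hp ρ τ hN hρ hτ x₀ hx₀
  have hcnt := card_fixed_add_classes τ hp hτ
  rw [hB] at hcnt
  set m := (blockClasses τ 13).card with hmdef
  have hm : m = 48 ∨ m = 49 ∨ m = 50 ∨ m = 51 := by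
    by_contra hne
    exact cs_contra m 13 σ (by exact_mod_cast cs) (cs13 m (Finset.mem_range.mpr (by omega)) hm1
      (fun h => hne (Or.inl h)) (fun h => hne (Or.inr (Or.inl h))) (fun h => hne (Or.inr (Or.inr (Or.inl h))))
      (fun h => hne (Or.inr (Or.inr (Or.inr h)))))
  set F := (univ.filter fun y => τ y = y).card with hFdef
  -- arithmetic at a fixed point / pair, as functions of F
  have single : ∀ x, ρ x = x → ∃ a : ℤ, (∑ y ∈ univ.filter (fun y => τ y = y), N x y) + 13 * a = 333 ∧
      0 ≤ ∑ y ∈ univ.filter (fun y => τ y = y), N x y ∧ ∑ y ∈ univ.filter (fun y => τ y = y), N x y ≤ (F : ℤ) := by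
    intro x hx
    obtain ⟨a, ha⟩ := fixedPoint_row N hrow hp ρ τ hN hτ hx
    obtain ⟨c0, c1⟩ := fixedCount_bounds N h01 τ x
    exact ⟨a, by exact_mod_cast ha, c0, c1⟩
  have pair : ∀ x x', ρ x = x → ρ x' = x' → x ≠ x' →
      ∃ t : ℤ, (∑ y ∈ univ.filter (fun y => τ y = y), N x y * N x' y) + 13 * t = 166 ∧
      0 ≤ ∑ y ∈ univ.filter (fun y => τ y = y), N x y * N x' y ∧
      ∑ y ∈ univ.filter (fun y => τ y = y), N x y * N x' y ≤ ∑ y ∈ univ.filter (fun y => τ y = y), N x y := by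
    intro x x' hx hx' hxx'
    obtain ⟨t, ht⟩ := fixedPair N hp ρ τ hN hτ hx hx' (hpair x x' hxx')
    obtain ⟨u0, u1⟩ := pairCount_bounds N h01 τ x x'
    exact ⟨t, by exact_mod_cast ht, u0, u1⟩
  have hF : F = 43 ∨ F = 30 ∨ F = 17 ∨ F = 4 := by omega
  -- F = 4 and F = 17 die at the pair (x₁, x₂)
  obtain ⟨a₁, ha₁, c₁0, c₁1⟩ := single x₁ hx₁
  obtain ⟨t₁, ht₁, u₁0, u₁1⟩ := pair x₁ x₂ hx₁ hx₂ h12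
  rcases hF with h | h | h | h
  · right
    refine ⟨h, fun x hx => ?_⟩
    obtain ⟨a, ha, c0, c1⟩ := single x hx
    -- pair x with a different fixed point to get c ≥ 10
    have hc10 : 10 ≤ ∑ y ∈ univ.filter (fun y => τ y = y), N x y := by
      by_cases hx1 : x = x₁
      · subst hx1
        omega
      · obtain ⟨t, ht, u0, u1⟩ := pair x x₁ hx hx₁ hx1
        omega
    rw [h] at c1; push_cast at c1; omega
  · left
    refine ⟨h, fun x hx => ?_, fun x x' hx hx' hxx' => ?_⟩
    · obtain ⟨a, ha, c0, c1⟩ := single x hx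
      have hc10 : 10 ≤ ∑ y ∈ univ.filter (fun y => τ y = y), N x y := by
        by_cases hx1 : x = x₁
        · subst hx1
          omega
        · obtain ⟨t, ht, u0, u1⟩ := pair x x₁ hx hx₁ hx1
          omega
      rw [h] at c1; push_cast at c1; omega
    · obtain ⟨a, ha, c0, c1⟩ := single x hx
      obtain ⟨t, ht, u0, u1⟩ := pair x x' hx hx' hxx'
      rw [h] at c1; push_cast at c1; omega
  · exfalso; rw [h] at c₁1; push_cast at c₁1; omega
  · exfalso; rw [h] at c₁1; push_cast at c₁1; omega

/-- counting lemma, `30 + 30`: impossible -/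
lemma count13_30_30 (N : P → B → ℤ) (h01 : ∀ x y, N x y = 0 ∨ N x y = 1) (ρ : Equiv.Perm P) (τ : Equiv.Perm B)
    (hFP : (univ.filter fun x => ρ x = x).card = 30)
    (hc : ∀ x, ρ x = x → ∑ y ∈ univ.filter (fun y => τ y = y), N x y = 21)
    (hu : ∀ x x', ρ x = x → ρ x' = x' → x ≠ x' → ∑ y ∈ univ.filter (fun y => τ y = y), N x y * N x' y = 10)
    (hc' : ∀ y, τ y = y → ∑ x ∈ univ.filter (fun x => ρ x = x), N x y = 21) : False := by
  set FP := univ.filter fun x => ρ x = x with hFPdef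
  set FB := univ.filter fun y => τ y = y with hFBdef
  obtain ⟨x, hx⟩ : FP.Nonempty := Finset.card_pos.mp (by omega)
  have hxfix : ρ x = x := (Finset.mem_filter.mp hx).2
  have way1 : ∑ x' ∈ FP, ∑ y ∈ FB, N x y * N x' y = 21 * 21 := by
    rw [Finset.sum_comm]
    have : ∀ y ∈ FB, ∑ x' ∈ FP, N x y * N x' y = N x y * 21 := by
      intro y hy; rw [← Finset.mul_sum, hc' y (Finset.mem_filter.mp hy).2]
    rw [Finset.sum_congr rfl this, ← Finset.sum_mul, hc x hxfix]
  have way2 : ∑ x' ∈ FP, ∑ y ∈ FB, N x y * N x' y = 21 + 29 * 10 := by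
    rw [← Finset.add_sum_erase FP _ hx]
    have hself : ∑ y ∈ FB, N x y * N x y = 21 := by
      rw [Finset.sum_congr rfl (fun y _ => show N x y * N x y = N x y by
        rcases h01 x y with h | h <;> simp [h]), hc x hxfix]
    have hrest : ∀ x' ∈ FP.erase x, ∑ y ∈ FB, N x y * N x' y = 10 :=
      fun x' hx' => hu x x' hxfix (Finset.mem_filter.mp (Finset.mem_of_mem_erase hx')).2
        (Finset.ne_of_mem_erase hx').symm
    rw [hself, Finset.sum_congr rfl hrest, Finset.sum_const, Finset.card_erase_of_mem hx, hFP]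
    norm_num
  rw [way1] at way2
  norm_num at way2

/-- counting lemma, `43` fixed points with `c = 21`, `u = 10` against `30` fixed blocks with `c' ∈ {21, 34}`: impossible -/
lemma count13_30_43 (N : P → B → ℤ) (h01 : ∀ x y, N x y = 0 ∨ N x y = 1) (ρ : Equiv.Perm P) (τ : Equiv.Perm B)
    (hFP : (univ.filter fun x => ρ x = x).card = 43) (hFB : (univ.filter fun y => τ y = y).card = 30)
    (hc : ∀ x, ρ x = x → ∑ y ∈ univ.filter (fun y => τ y = y), N x y = 21)
    (hu : ∀ x x', ρ x = x → ρ x' = x' → x ≠ x' → ∑ y ∈ univ.filter (fun y => τ y = y), N x y * N x' y = 10)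
    (hc' : ∀ y, τ y = y → ∑ x ∈ univ.filter (fun x => ρ x = x), N x y = 21 ∨
      ∑ x ∈ univ.filter (fun x => ρ x = x), N x y = 34) : False := by
  set FP := univ.filter fun x => ρ x = x with hFPdef
  set FB := univ.filter fun y => τ y = y with hFBdef
  let cd : B → ℤ := fun y => ∑ x ∈ FP, N x y
  -- T = Σ_x Σ_x' u(x,x') = 43 · 441
  have rowT : ∀ x ∈ FP, ∑ x' ∈ FP, ∑ y ∈ FB, N x y * N x' y = 441 := by
    intro x hx
    have hxfix : ρ x = x := (Finset.mem_filter.mp hx).2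
    rw [← Finset.add_sum_erase FP _ hx]
    have hself : ∑ y ∈ FB, N x y * N x y = 21 := by
      rw [Finset.sum_congr rfl (fun y _ => show N x y * N x y = N x y by
        rcases h01 x y with h | h <;> simp [h]), hc x hxfix]
    have hrest : ∀ x' ∈ FP.erase x, ∑ y ∈ FB, N x y * N x' y = 10 :=
      fun x' hx' => hu x x' hxfix (Finset.mem_filter.mp (Finset.mem_of_mem_erase hx')).2
        (Finset.ne_of_mem_erase hx').symm
    rw [hself, Finset.sum_congr rfl hrest, Finset.sum_const, Finset.card_erase_of_mem hx, hFP]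
    norm_num
  have T1 : ∑ x ∈ FP, ∑ x' ∈ FP, ∑ y ∈ FB, N x y * N x' y = 43 * 441 := by
    rw [Finset.sum_congr rfl rowT, Finset.sum_const, hFP]; norm_num
  -- T = Σ_y cd y ^ 2
  have T2 : ∑ x ∈ FP, ∑ x' ∈ FP, ∑ y ∈ FB, N x y * N x' y = ∑ y ∈ FB, cd y * cd y := by
    have step : ∀ x ∈ FP, ∑ x' ∈ FP, ∑ y ∈ FB, N x y * N x' y = ∑ y ∈ FB, N x y * cd y := by
      intro x _
      rw [Finset.sum_comm]
      exact Finset.sum_congr rfl fun y _ => by rw [Finset.mul_sum]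
    rw [Finset.sum_congr rfl step, Finset.sum_comm]
    exact Finset.sum_congr rfl fun y _ => by rw [Finset.sum_mul]
  -- S = Σ_y cd y = Σ_x c x = 903
  have S : ∑ y ∈ FB, cd y = 903 := by
    show ∑ y ∈ FB, ∑ x ∈ FP, N x y = 903
    rw [Finset.sum_comm, Finset.sum_congr rfl (fun x hx => hc x (Finset.mem_filter.mp hx).2), Finset.sum_const, hFP]
    norm_num
  -- Σ_y cd y (cd y - 21) = 0 with nonnegative terms
  have hz : ∑ y ∈ FB, cd y * (cd y - 21) = 0 := by
    have : ∑ y ∈ FB, cd y * (cd y - 21) = ∑ y ∈ FB, cd y * cd y - 21 * ∑ y ∈ FB, cd y := by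
      rw [Finset.mul_sum, ← Finset.sum_sub_distrib]
      exact Finset.sum_congr rfl fun y _ => by ring
    rw [this, ← T2, T1, S]; norm_num
  have hnn : ∀ y ∈ FB, 0 ≤ cd y * (cd y - 21) := by
    intro y hy
    rcases hc' y (Finset.mem_filter.mp hy).2 with h | h
    · show 0 ≤ cd y * (cd y - 21); rw [show cd y = 21 from h]; norm_num
    · show 0 ≤ cd y * (cd y - 21); rw [show cd y = 34 from h]; norm_num
  have hall := (Finset.sum_eq_zero_iff_of_nonneg hnn).mp hz
  have h21 : ∀ y ∈ FB, cd y = 21 := by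
    intro y hy
    have e := hall y hy
    rcases hc' y (Finset.mem_filter.mp hy).2 with h | h
    · exact h
    · exfalso; rw [show cd y = 34 from h] at e; norm_num at e
  have : ∑ y ∈ FB, cd y = 30 * 21 := by
    rw [Finset.sum_congr rfl h21, Finset.sum_const, hFB]; norm_num
  rw [S] at this
  norm_num at this

/-- **Order 13: `43` fixed points, `43` fixed blocks, `48 + 48` orbits** — kernel, no parity theorem. -/
theorem orbitStructure_13 (N : P → B → ℤ) (h01 : ∀ x y, N x y = 0 ∨ N x y = 1)
    (hrow : ∀ x, ∑ y, N x y = 333) (hpair : ∀ x x', x ≠ x' → ∑ y, N x y * N x' y = 166)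
    (hcol : ∀ y, ∑ x, N x y = 333) (hcpair : ∀ y y', y ≠ y' → ∑ x, N x y * N x y' = 166)
    (hP : Fintype.card P = 667) (hB : Fintype.card B = 667)
    (ρ : Equiv.Perm P) (τ : Equiv.Perm B) (hN : ∀ x y, N (ρ x) (τ y) = N x y)
    (hρ : ρ ^ 13 = 1) (hτ : τ ^ 13 = 1) (x₀ : P) (hx₀ : ρ x₀ ≠ x₀) :
    (univ.filter fun y => τ y = y).card = 43 ∧ (univ.filter fun x => ρ x = x).card = 43 ∧
    (blockClasses τ 13).card = 48 ∧ (blockClasses ρ 13).card = 48 := by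
  have hp : (13 : ℕ).Prime := by norm_num
  -- two fixed points and two fixed blocks: counts ≡ 667 ≡ 4 (mod 13)
  have hfp := card_fixed_mod ρ hp hρ
  rw [hP] at hfp
  have hfb := card_fixed_mod τ hp hτ
  rw [hB] at hfb
  obtain ⟨x₁, hx₁, x₂, hx₂, h12⟩ := Finset.one_lt_card.mp
    (show 1 < (univ.filter fun x => ρ x = x).card by omega)
  obtain ⟨y₁, hy₁, y₂, hy₂, hy12⟩ := Finset.one_lt_card.mp
    (show 1 < (univ.filter fun y => τ y = y).card by omega)
  have hx₁f : ρ x₁ = x₁ := (Finset.mem_filter.mp hx₁).2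
  have hx₂f : ρ x₂ = x₂ := (Finset.mem_filter.mp hx₂).2
  have hy₁f : τ y₁ = y₁ := (Finset.mem_filter.mp hy₁).2
  have hy₂f : τ y₂ = y₂ := (Finset.mem_filter.mp hy₂).2
  -- dual structure
  let N' : B → P → ℤ := fun y x => N x y
  have h01' : ∀ y x, N' y x = 0 ∨ N' y x = 1 := fun y x => h01 x y
  have hN' : ∀ y x, N' (τ y) (ρ x) = N' y x := fun y x => hN x y
  obtain ⟨y₀, hy₀⟩ := exists_moved_block N h01 hrow hpair ρ τ hN hx₀
  have sB := side13 N h01 hrow hpair hB ρ τ hN hρ hτ x₀ hx₀ hx₁f hx₂f h12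
  have sP := side13 N' h01' hcol hcpair hP τ ρ hN' hτ hρ y₀ hy₀ hy₁f hy₂f hy12
  have hcntB := card_fixed_add_classes τ hp hτ
  rw [hB] at hcntB
  have hcntP := card_fixed_add_classes ρ hp hρ
  rw [hP] at hcntP
  rcases sB with ⟨hB30, hcB, huB⟩ | ⟨hB43, hcB⟩ <;> rcases sP with ⟨hP30, hcP, huP⟩ | ⟨hP43, hcP⟩
  · exact (count13_30_30 N h01 ρ τ hP30 hcB huB hcP).elim
  · exact (count13_30_43 N h01 ρ τ hP43 hB30 hcB huB hcP).elim
  · exact (count13_30_43 N' h01' τ ρ hB43 hP30 hcP huP hcB).elim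
  · exact ⟨hB43, hP43, by omega, by omega⟩

end Summit.Ventures.DiscreteObjects.Hadamard
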